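import Mathlib.Analysis.Calculus.InverseFunctionTheorem.ContDiff
import HarnessLib

/-!
# Injective local diffeomorphisms on open sets: open images and a smooth inverse on the image

General calculus (topic `Geometry/Manifold`, next to `OpenEmbeddingCriterion.lean`; everything
PROVED, no definitions).  The global form of the inverse function theorem used to turn the explicit
local models of block 2 of Akhmedov–Park's `X₁(m)` (the resolution neck
`DoublePointResolutionNeck.lean` and the blow-up cap `BlowUpLineCapTube.lean`, maps
`ℂ × ℂ → ℂ × ℂ` that are injective on an open set `U` with an invertible strict derivative at every
point of `U`) into open embeddings with smooth inverse: **a map with invertible strict derivatives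
on an open set sends open subsets to open sets** (`isOpen_image_of_forall_hasStrictFDerivAt_equiv`,
from `HasStrictFDerivAt.map_nhds_eq_of_equiv`), and **if moreover injective and `Cⁿ` on `U`, its
inverse `invFunOn f U` is `Cⁿ` on the image `f '' U`** (`contDiffOn_invFunOn_of_forall_hasStrictFDerivAt_equiv`:
near `f a` the inverse agrees with Mathlib's `ContDiffAt.localInverse`, which is `Cⁿ`,
`ContDiffAt.to_localInverse`).

## References

* J. M. Lee, *Introduction to Smooth Manifolds*, 2nd ed. (2013), Thm. 4.5 and Prop. 4.22
  (inverse function theorem; injective local diffeomorphisms are embeddings). [LeeSmoothManifolds2013]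
-/

noncomputable section

open scoped Topology ContDiff
open Set Function Filter

namespace Literature.Geometry.Manifold

variable {E F : Type*} [NormedAddCommGroup E] [NormedSpace ℝ E] [CompleteSpace E]
  [NormedAddCommGroup F] [NormedSpace ℝ F]

/-- **Invertible strict derivatives make images of open sets open.** [cite: LeeSmoothManifolds2013, Prop. 4.22] -/
theorem isOpen_image_of_forall_hasStrictFDerivAt_equiv {f : E → F} {V : Set E} (hV : IsOpen V)
    (hd : ∀ p ∈ V, ∃ L : E ≃L[ℝ] F, HasStrictFDerivAt f (L : E →L[ℝ] F) p) : IsOpen (f '' V) := by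
  rw [isOpen_iff_mem_nhds]
  rintro _ ⟨p, hp, rfl⟩
  obtain ⟨L, hL⟩ := hd p hp
  rw [← hL.map_nhds_eq_of_equiv]
  exact image_mem_map (hV.mem_nhds hp)

/-- The restriction to any open subset is again an open map onto its image. [folklore] -/
theorem isOpen_image_of_subset_of_forall_hasStrictFDerivAt_equiv {f : E → F} {U V : Set E}
    (hd : ∀ p ∈ U, ∃ L : E ≃L[ℝ] F, HasStrictFDerivAt f (L : E →L[ℝ] F) p) (hV : IsOpen V)
    (hVU : V ⊆ U) : IsOpen (f '' V) :=
  isOpen_image_of_forall_hasStrictFDerivAt_equiv hV fun p hp => hd p (hVU hp)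

/-- **The inverse of an injective `Cⁿ` map with invertible strict derivatives on an open set is
`Cⁿ` on the image** (`n ≠ 0`). [cite: LeeSmoothManifolds2013, Thm. 4.5] -/
theorem contDiffOn_invFunOn_of_forall_hasStrictFDerivAt_equiv [Nonempty E] {n : WithTop ℕ∞}
    {f : E → F} {U : Set E} (hU : IsOpen U) (hf : ContDiffOn ℝ n f U) (hn : n ≠ 0)
    (hinj : InjOn f U) (hd : ∀ p ∈ U, ∃ L : E ≃L[ℝ] F, HasStrictFDerivAt f (L : E →L[ℝ] F) p) :
    ContDiffOn ℝ n (invFunOn f U) (f '' U) := by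
  rintro _ ⟨a, ha, rfl⟩
  obtain ⟨L, hL⟩ := hd a ha
  have hfa : ContDiffAt ℝ n f a := hf.contDiffAt (hU.mem_nhds ha)
  have hleft : ∀ᶠ x in 𝓝 a, invFunOn f U (f x) = x :=
    eventually_of_mem (hU.mem_nhds ha) fun x hx => hinj.leftInvOn_invFunOn hx
  have heq := hL.localInverse_unique hleft
  have hli : ContDiffAt ℝ n (hfa.localInverse hL.hasFDerivAt hn) (f a) :=
    hfa.to_localInverse hL.hasFDerivAt hn
  have hat : ContDiffAt ℝ n (invFunOn f U) (f a) := hli.congr_of_eventuallyEq heq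
  exact hat.contDiffWithinAt

/-- **Continuity form**: an injective map with invertible strict derivatives on an open set `U`
is open at every point of `U`: the neighbourhood filter of `f p` is the image of that of `p`. [cite: LeeSmoothManifolds2013, Prop. 4.22] -/
theorem map_nhds_eq_of_forall_hasStrictFDerivAt_equiv {f : E → F} {U : Set E}
    (hd : ∀ p ∈ U, ∃ L : E ≃L[ℝ] F, HasStrictFDerivAt f (L : E →L[ℝ] F) p) {p : E} (hp : p ∈ U) :
    map f (𝓝 p) = 𝓝 (f p) := by
  obtain ⟨L, hL⟩ := hd p hp
  exact hL.map_nhds_eq_of_equiv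

end Literature.Geometry.Manifold
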